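import Literature.MathematicalPhysics.QuantumFieldTheory.Balaban1983to89.Step

/-!
# B12 (1.9) / p. 261 / (1.18) p. 263 — the ANALYTICITY clause of the small-field inductive description, WITH BODY

CITATION HEADER (lean-in-tree rule 2026-08-18).  Source: T. Bałaban, *Renormalization group approach to lattice gauge field
theories. I. Generation of effective actions in a small field approximation and a coupling constant renormalization in four
dimensions*, Comm. Math. Phys. **109** (1987) 249–301 [Balaban1987RG1], §1 pp. 261–263 and §3 pp. 271–273.

PRINT, VERBATIM (text layer `paper:balaban1987-cmp109-rg-i-small-field`, pp. 261, 263, 272–273).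
* p. 261 [PDF 13]: *«The terms in (1.3) given by explicit formulas, like (1.4), can be easily extended, by the same formulas,
  to a much wider class of regular gauge field configurations. For example we can extend to G^c-valued configurations
  satisfying the conditions (3.35)–(3.38) [13], and from results of that paper we conclude that these terms are analytic
  functions of the configurations. We assume that extensions of this type exist for all terms in the effective action (1.3),
  or (1.6).»* … *«Thus we assume that there are functions 𝐄^{(j)}(X, g_{j−1}, 𝐔, 𝐉), analytic on a space of regular, complex
  configurations 𝐔, 𝐉, such that  E^{(j)}(X, g_{j−1}, U_j) = 𝐄^{(j)}(X, g_{j−1}, U_j, J_j).  (1.9)»*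
* p. 263 [PDF 15]: *«We assume that the function 𝐄^{(j)}(X, g_{j−1}, 𝐔, 𝐉) is defined and analytic on the space
  U^c_j(X, α₀, α₁), with some positive, absolute constants α₀, α₁ (i.e., constants independent of X and j). It depends on
  the configurations restricted to X, i.e. on (𝐔, 𝐉)|_X. It is a C^∞-function of g_{j−1} ∈ [0, γ], (or analytic), with a
  positive, absolute γ. There exists a constant E₀ such that  |𝐄^{(j)}(X, g_{j−1}, 𝐔, 𝐉)| ≤ E₀ exp(−κ d_j(X))  (1.18)
  for M ≥ M(κ), γ sufficiently small, and for all configurations (𝐔, 𝐉) ∈ U^c_j(X, α₀, α₁).»*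
* p. 272 [PDF 24] (where print CONSUMES the clause): *«To fulfill the conditions of the inductive assumption we have to
  construct an analytic extension of the expression (3.7). Let us consider more generally the function
  𝐄^{(j)}(X, exp iξ𝐀 U_{k+1}). It is obtained from the analytic function 𝐄^{(j)}(X, 𝐔′, 𝐉′) by the substitution (3.10)»* …
  *«It is an analytic function on this space, and also an analytic function of 𝐀»*; p. 273 [PDF 25]: *«The derivative with
  respect to t_□, at t_□ = 0, can be written as the Cauchy integral (3.15)»*.

WHAT THIS FILE TYPES AND PROVES (0 `sorry`; one `structure` and one `def`, both WITH BODY, + theorems; no named fact).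
* §1 **THE CLAUSE WITH BODY** — `SFHypAnalytic T c k`: for every scale `1 ≤ j ≤ k`, every localization domain `X ∈ 𝐃_j` and
  every coupling `g ∈ [0, γ]` at which `Step.SFHyp.bound118` is demanded, the extended term `T.E j X g : Φ → ℂ` of the
  small-field tower (`Step.SFTower`, B12 (1.7)–(1.9)) is HOLOMORPHIC (`AnalyticOnNhd ℂ`) on the space `T.space j X c.α₀ c.α₁`
  = U^c_j(X, α₀, α₁) — the SAME set on which `Step.SFHyp.bound118` types the bound (1.18).  `Step.SFHyp` types (1.7),
  (1.18)-the-bound, (1.19), the β-clauses and the space invariance but NOT the word «analytic» (its docstring: «analyticity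
  in φ [is] NOT typed (no complex structure on the abstract Φ; D-f2.1)»); this file supplies exactly that clause, giving `Φ`
  the complex normed structure the word presupposes.  CARRIER READING: print's (𝐔, 𝐉) are `G^c × 𝔤^c`-valued bond functions
  on the finite set of bonds of `X`, `G^c ⊂ GL(N, ℂ) ⊂ Mat_N(ℂ)` (p. 262 (1.11)–(1.16)) — a finite-dimensional complex normed
  space; print's space U^c_j(X, α₀, α₁) is OPEN (the inequalities (1.11)–(1.14) are strict), and on an open set
  `AnalyticOnNhd ℂ f s` IS «f analytic on s»; on the abstract `T.space` it is the only meaningful reading (holomorphic near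
  each point of the set).  The ONE-CARRIER INSTANTIATION `Φ` = the (1.11)–(1.16) bond-function space is identified nowhere in
  the tree (DIVERGENCE D-f2.1) and is housed at B12 Thm 3.  `SFAnalyticAt T c k` is the same clause AT THE NEW INDEX `k+1`
  (the shape of `Step.SFNewTerm`); `mono`, `zero`, `succ`, `newTerm`, `succ_iff` are the cumulative bookkeeping of
  `Step.SFHyp.mono/zero/succ/newTerm/succ_iff`.
* (1.9), the extension equality «E^{(j)}(X, g_{j−1}, U_j) = 𝐄^{(j)}(X, g_{j−1}, U_j, J_j)», is DEFINITIONAL in the tower: the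
  real term IS the extension read at `T.ofBackground U = (U, J(U))` (`Step.SFTower.action13/action16`, and the concrete
  substitution `B12Eq18Current.ofBackground`); `analyticAt_E_ofBackground` records the pointwise consequence at a real
  background inside the space.  p. 261's «all terms in (1.3), or (1.6)»: in the (1.6) reading of the tower
  (`Step.SFTower.action16`, DIVERGENCE D-f2.3) every term of the effective action beyond the Wilson actions is an
  `𝐄^{(j)}`-term, so `SFHypAnalytic` IS the assumed extension «for all terms»; in the (1.3) reading the zeroth-order terms
  `log Z^{(j)}` are carried REAL (`T.logZ : ℕ → GaugeField P 0 G → ℝ`) and their explicit extension «by the same formulas»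
  ((1.4)–(1.5), [13]) is not an object of the tower — HONEST SCOPE (1).
* §2 **WHERE PRINT CONSUMES THE CLAUSE** (§3 pp. 271–273): composed with any holomorphic chart `ch : E → Φ` mapping a set
  `s` into the space — print's substitution (3.10) `𝐀 ↦ (exp iξ𝐀 U_{k+1}, 𝐉′(𝐀))` — the chart functional `T.E j X g ∘ ch`
  is holomorphic on `s` (`analyticOnNhd_E_chart`; «It is an analytic function on this space, and also an analytic function
  of 𝐀»); for a holomorphic ONE-PARAMETER family `ℂ → Φ` into the space (print's `t_□ ↦ 𝐀 = H_k(B(t)) + t_□⟨…⟩` of (3.15)) the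
  function `t ↦ 𝐄^{(j)}(X, g, γ(t))` is `DifferentiableOn ℂ` on the parameter set (`differentiableOn_E_line`) — exactly the
  hypothesis `hΦ : DifferentiableOn ℂ Φ (ball 0 R)` of the tree's Cauchy-estimate consumers `B12CauchyRemainder354.ineq317` /
  `taylor5_remainder_norm_le` ((3.15)–(3.17), (3.54)).  The geometric inclusion `MapsTo ch s (T.space …)` (print's radius
  condition after (3.15), «r max{…} = ½α₂») is the HYPOTHESIS `hmaps`, not proved here — HONEST SCOPE (2).
* HONEST SCOPE (3): the g-regularity half of the p. 263 sentence («C^∞-function of g_{j−1} ∈ [0, γ], (or analytic)») is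
  typed in `B12BetaSmooth` (`ESmoothHyp` / `ESmoothAt` / `EAnalyticAt`, real-analytic WITHIN `[0, γ]`), the bound (1.18) and
  «depends on (𝐔, 𝐉)|_X» in `Step.SFHyp` (`bound118`, `localDep`); this file does not repeat them.  Nothing here asserts that
  Bałaban's concrete renormalization-group terms satisfy the clause — that is the content of Theorem 3 (row B12.Thm3).

statement-level skeleton of published theorems with citation tags; proofs where landed; nothing here is a claim about the
Yang–Mills mass gap.
-/

namespace Literature.MathematicalPhysics.QuantumFieldTheory.Balaban1983to89.B12.Eq118Analyticity263

open Literature.MathematicalPhysics.QuantumFieldTheory.Balaban1983to89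
open Step Set

variable {P : Params} {G : Type*} [GaugeGroup G] {Φ 𝒢 : Type*}

/-! ## §1  The analyticity clause of (1.9) / p. 261 / (1.18) p. 263, WITH BODY -/

/-- **p. 263 WITH BODY** — *«We assume that the function 𝐄^{(j)}(X, g_{j−1}, 𝐔, 𝐉) is defined and analytic on the space
U^c_j(X, α₀, α₁)»*, for the terms `j = 1, …, k` of the small-field tower and every coupling `g ∈ [0, γ]` (the range of
`g_{j−1}` in (1.18)); equivalently (1.9) p. 261 *«there are functions 𝐄^{(j)}(X, g_{j−1}, 𝐔, 𝐉), analytic on a space of regular,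
complex configurations 𝐔, 𝐉»*.  `Φ` carries a complex normed structure (print's (𝐔, 𝐉): `G^c × 𝔤^c`-valued bond functions,
p. 262); print's space is open, on it «analytic» = `AnalyticOnNhd ℂ`.  Companion of `Step.SFHyp`, which types the other
clauses of the same sentence on the same set `T.space j X c.α₀ c.α₁`. [cite: Balaban1987RG1, (1.9) p.261, (1.18) p.263] -/
structure SFHypAnalytic [NormedAddCommGroup Φ] [NormedSpace ℂ Φ] (T : SFTower P G Φ 𝒢) (c : SFConsts) (k : ℕ) :
    Prop where
  analyticE : ∀ j, 1 ≤ j → j ≤ k → ∀ (X : (T.sys j).Dom) (g : ℝ), 0 ≤ g → g ≤ c.γ →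
    AnalyticOnNhd ℂ (T.E j X g) (T.space j X c.α₀ c.α₁)

/-- The same clause AT THE NEW INDEX `k+1` — the analyticity obligation of the step `k → k+1` (p. 272: *«To fulfill the
conditions of the inductive assumption we have to construct an analytic extension of the expression (3.7)»*), in the shape of
`Step.SFNewTerm`. [cite: Balaban1987RG1, (1.18) p.263, p.272] -/
def SFAnalyticAt [NormedAddCommGroup Φ] [NormedSpace ℂ Φ] (T : SFTower P G Φ 𝒢) (c : SFConsts) (k : ℕ) : Prop :=
  ∀ (X : (T.sys (k+1)).Dom) (g : ℝ), 0 ≤ g → g ≤ c.γ → AnalyticOnNhd ℂ (T.E (k+1) X g) (T.space (k+1) X c.α₀ c.α₁)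

namespace SFHypAnalytic

variable [NormedAddCommGroup Φ] [NormedSpace ℂ Φ] {T : SFTower P G Φ 𝒢} {c : SFConsts} {k : ℕ}

/-- The clause on the scales `≤ k` restricts to the scales `≤ j` for `j ≤ k` (the data is cumulative: *«in the old only a
background field is changed»*, (0.23) p. 256). [cite: Balaban1987RG1, (0.23) p.256] -/
theorem mono (h : SFHypAnalytic T c k) {j : ℕ} (hjk : j ≤ k) : SFHypAnalytic T c j where
  analyticE := fun i h1 hi => h.analyticE i h1 (le_trans hi hjk)

/-- At `k = 0` there are no terms (`A₀ = −(1/g₀²)A`, (0.17)): the clause is vacuous. [cite: Balaban1987RG1, (0.17) p.255] -/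
theorem zero (T : SFTower P G Φ 𝒢) (c : SFConsts) : SFHypAnalytic T c 0 where
  analyticE := fun j h1 hj => absurd hj (by omega)

/-- One step of bookkeeping: the clause at the scales `≤ k` and at the new index `k+1` give the clause at the scales `≤ k+1`
(the old terms are unchanged, p. 256). [cite: Balaban1987RG1, (0.23) p.256] -/
theorem succ (h : SFHypAnalytic T c k) (hn : SFAnalyticAt T c k) : SFHypAnalytic T c (k+1) where
  analyticE := fun j h1 hj => by
    rcases Nat.of_le_succ hj with hj' | rfl
    · exact h.analyticE j h1 hj'
    · exact hn

/-- Conversely, the clause at the scales `≤ k+1` contains the clause at the new index. [cite: Balaban1987RG1, (1.18) p.263] -/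
theorem newTerm (h : SFHypAnalytic T c (k+1)) : SFAnalyticAt T c k :=
  h.analyticE (k+1) k.succ_pos le_rfl

/-- `SFHypAnalytic T c (k+1) ↔ SFHypAnalytic T c k ∧ SFAnalyticAt T c k`. [cite: Balaban1987RG1, (1.18) p.263] -/
theorem succ_iff : SFHypAnalytic T c (k+1) ↔ SFHypAnalytic T c k ∧ SFAnalyticAt T c k :=
  ⟨fun h => ⟨h.mono (Nat.le_succ k), h.newTerm⟩, fun h => h.1.succ h.2⟩

/-- An analytic function on the space is in particular continuous there. [cite: Balaban1987RG1, (1.18) p.263] -/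
theorem continuousOn_E (h : SFHypAnalytic T c k) {j : ℕ} (h1 : 1 ≤ j) (hj : j ≤ k) (X : (T.sys j).Dom) {g : ℝ}
    (hg0 : 0 ≤ g) (hgγ : g ≤ c.γ) : ContinuousOn (T.E j X g) (T.space j X c.α₀ c.α₁) :=
  (h.analyticE j h1 hj X g hg0 hgγ).continuousOn

/-- … and complex-differentiable there. [cite: Balaban1987RG1, (1.18) p.263] -/
theorem differentiableOn_E (h : SFHypAnalytic T c k) {j : ℕ} (h1 : 1 ≤ j) (hj : j ≤ k) (X : (T.sys j).Dom) {g : ℝ}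
    (hg0 : 0 ≤ g) (hgγ : g ≤ c.γ) : DifferentiableOn ℂ (T.E j X g) (T.space j X c.α₀ c.α₁) :=
  (h.analyticE j h1 hj X g hg0 hgγ).differentiableOn

/-- **(1.9) at a real background.**  The real term `E^{(j)}(X, g_{j−1}, U_j)` IS the extension read at
`T.ofBackground U = (U_j, J_j)` (definitional in the tower); when that point lies in the space (p. 263: *«In particular the
minimal configurations U_j … satisfy the above conditions»*), the extension is analytic AT it. [cite: Balaban1987RG1, (1.9) p.261, p.263] -/
theorem analyticAt_E_ofBackground (h : SFHypAnalytic T c k) {j : ℕ} (h1 : 1 ≤ j) (hj : j ≤ k) (X : (T.sys j).Dom)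
    {g : ℝ} (hg0 : 0 ≤ g) (hgγ : g ≤ c.γ) {U : GaugeField P 0 G} (hU : T.ofBackground U ∈ T.space j X c.α₀ c.α₁) :
    AnalyticAt ℂ (T.E j X g) (T.ofBackground U) :=
  h.analyticE j h1 hj X g hg0 hgγ _ hU

/-! ## §2  Where print consumes the clause: holomorphic charts into the space (§3, (3.10)–(3.15) pp. 272–273) -/

variable {E : Type*} [NormedAddCommGroup E] [NormedSpace ℂ E]

/-- **The clause in a chart** (p. 272, (3.10)/(3.13): *«It is obtained from the analytic function 𝐄^{(j)}(X, 𝐔′, 𝐉′) by the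
substitution 𝐔′ = exp iξ𝐀U_{k+1}, 𝐉′ = … It is an analytic function on this space, and also an analytic function of 𝐀»*): for
any holomorphic map `ch : E → Φ` sending a set `s` into U^c_j(X, α₀, α₁), the chart functional `𝐀 ↦ 𝐄^{(j)}(X, g, ch 𝐀)` is
holomorphic on `s`.  The inclusion `hmaps` is print's smallness condition (3.14) on 𝐀, a hypothesis here. [cite: Balaban1987RG1, (3.10)–(3.14) p.272] -/
theorem analyticOnNhd_E_chart (h : SFHypAnalytic T c k) {j : ℕ} (h1 : 1 ≤ j) (hj : j ≤ k) (X : (T.sys j).Dom) {g : ℝ}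
    (hg0 : 0 ≤ g) (hgγ : g ≤ c.γ) {ch : E → Φ} {s : Set E} (hch : AnalyticOnNhd ℂ ch s)
    (hmaps : MapsTo ch s (T.space j X c.α₀ c.α₁)) : AnalyticOnNhd ℂ (fun A => T.E j X g (ch A)) s :=
  (h.analyticE j h1 hj X g hg0 hgγ).comp hch hmaps

/-- **The clause along a holomorphic one-parameter family** (p. 273, (3.15): *«The derivative with respect to t_□, at t_□ = 0,
can be written as the Cauchy integral»*): for a holomorphic curve `γ : ℂ → Φ` carrying a set `s ⊆ ℂ` into the space, the
function `t ↦ 𝐄^{(j)}(X, g, γ t)` is complex-differentiable on `s` — the hypothesis `hΦ : DifferentiableOn ℂ Φ (ball 0 R)` under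
which the tree's Cauchy estimates `B12CauchyRemainder354.ineq317` / `taylor5_remainder_norm_le` ((3.15)–(3.17), (3.54)) are
stated. [cite: Balaban1987RG1, (3.15) p.273] -/
theorem differentiableOn_E_line (h : SFHypAnalytic T c k) {j : ℕ} (h1 : 1 ≤ j) (hj : j ≤ k) (X : (T.sys j).Dom) {g : ℝ}
    (hg0 : 0 ≤ g) (hgγ : g ≤ c.γ) {γl : ℂ → Φ} {s : Set ℂ} (hγ : AnalyticOnNhd ℂ γl s)
    (hmaps : MapsTo γl s (T.space j X c.α₀ c.α₁)) : DifferentiableOn ℂ (fun t => T.E j X g (γl t)) s :=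
  (h.analyticOnNhd_E_chart h1 hj X hg0 hgγ hγ hmaps).differentiableOn

/-- The affine line `t ↦ φ₀ + t • H` (print's `𝐀 = H_k(B(t)) + t_□⟨…⟩`, linear in `t_□`) is an entire curve, so along it the
clause gives complex-differentiability on any parameter set carried into the space. [cite: Balaban1987RG1, (3.15) p.273] -/
theorem differentiableOn_E_affineLine (h : SFHypAnalytic T c k) {j : ℕ} (h1 : 1 ≤ j) (hj : j ≤ k) (X : (T.sys j).Dom)
    {g : ℝ} (hg0 : 0 ≤ g) (hgγ : g ≤ c.γ) (φ₀ H : Φ) {s : Set ℂ}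
    (hmaps : MapsTo (fun t : ℂ => φ₀ + t • H) s (T.space j X c.α₀ c.α₁)) :
    DifferentiableOn ℂ (fun t : ℂ => T.E j X g (φ₀ + t • H)) s :=
  h.differentiableOn_E_line h1 hj X hg0 hgγ
    (fun _ _ => analyticAt_const.add (analyticAt_id.smul analyticAt_const)) hmaps

end SFHypAnalytic

/-! ## §3  The new-index clause serves the step's consumers in the same two shapes -/

namespace SFAnalyticAt

variable [NormedAddCommGroup Φ] [NormedSpace ℂ Φ] {T : SFTower P G Φ 𝒢} {c : SFConsts} {k : ℕ}
variable {E : Type*} [NormedAddCommGroup E] [NormedSpace ℂ E]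

/-- The new term `𝐄^{(k+1)}` in a holomorphic chart into U^c_{k+1}(X, α₀, α₁). [cite: Balaban1987RG1, (1.18) p.263, p.272] -/
theorem analyticOnNhd_E_chart (h : SFAnalyticAt T c k) (X : (T.sys (k+1)).Dom) {g : ℝ} (hg0 : 0 ≤ g) (hgγ : g ≤ c.γ)
    {ch : E → Φ} {s : Set E} (hch : AnalyticOnNhd ℂ ch s) (hmaps : MapsTo ch s (T.space (k+1) X c.α₀ c.α₁)) :
    AnalyticOnNhd ℂ (fun A => T.E (k+1) X g (ch A)) s :=
  (h X g hg0 hgγ).comp hch hmaps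

/-- The new term along a holomorphic curve into the space is complex-differentiable in the parameter. [cite: Balaban1987RG1, (3.15) p.273] -/
theorem differentiableOn_E_line (h : SFAnalyticAt T c k) (X : (T.sys (k+1)).Dom) {g : ℝ} (hg0 : 0 ≤ g) (hgγ : g ≤ c.γ)
    {γl : ℂ → Φ} {s : Set ℂ} (hγ : AnalyticOnNhd ℂ γl s) (hmaps : MapsTo γl s (T.space (k+1) X c.α₀ c.α₁)) :
    DifferentiableOn ℂ (fun t => T.E (k+1) X g (γl t)) s :=
  (h.analyticOnNhd_E_chart X hg0 hgγ hγ hmaps).differentiableOn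

end SFAnalyticAt

end Literature.MathematicalPhysics.QuantumFieldTheory.Balaban1983to89.B12.Eq118Analyticity263
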